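import Summits.BirchSwinnertonDyer.BirchSwinnertonDyer.Theorems.KolyvaginDepthDoorKNSupplyExactReadingDepthRowLB
import Summits.BirchSwinnertonDyer.BirchSwinnertonDyer.Theorems.KolyvaginDepthDoorDepthTableRowsOfPrint4
import Summits.BirchSwinnertonDyer.BirchSwinnertonDyer.Theorems.KolyvaginDepthDoorDepthTableRowsOfPrint6
import Summits.BirchSwinnertonDyer.BirchSwinnertonDyer.Theorems.KolyvaginDepthDoorDepthTableRowKit
import Summits.BirchSwinnertonDyer.BirchSwinnertonDyer.Theorems.KolyvaginDepthDoorDepthTableRowKitPrint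
import Summits.BirchSwinnertonDyer.BirchSwinnertonDyer.Theorems.Rank2ObservatoryKernelCerts001
import Summits.BirchSwinnertonDyer.BirchSwinnertonDyer.Theorems.Rank2ObservatoryKernelCerts002
import Literature.NumberTheory.EllipticCurves.HeegnerHypothesisKroneckerProofs
import HarnessLib

/-!
# Route `KolyvaginDepthDoor`, crux `KolyvaginDepthSupplyKN` (stmt-BirchSwinnertonDyer-22820) —
# DEPTH-TABLE ROWS READ EXACTLY (two-sided, NO twist pinning, from TWO KNOWN POINTS):
# `664a1` at `(5, −39)`, `707a1` at `(5, −19)`, `916c1` at `(5, −111)` — the rank-2 rows of the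
# instrument table whose prime `p = 5` SPLITS in the Heegner field (two of them ♠ (2)-residual curves)

Helper file of the lead prover of line `levelone` (kdd-p1 g14; `--supports stmt-BirchSwinnertonDyer-22820
--as helper`); it closes nothing and BSD is not proved by it.

The row reading `kolyvaginClass_prime_ne_zero_iff_rankTwo_shaTrivial_twistSelmer_of_maninPrint` (file
`KolyvaginDepthDoorKNSupplyExactReadingDepthRowLB`) says, per `(E, p, K)` on the Kodaira–Néron cell with
`p` split in `K`, `d_K` odd and TWO INDEPENDENT POINTS on `E(ℚ)`: «∃ frame, Kolyvagin prime `ℓ`, datum: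
`c_1(ℓ) ≠ 0`» `↔` «`rank E(ℚ) = 2` ∧ `Ш(E/ℚ)[p] = 0` ∧ `#Sel_p(E^{(d_K)}/ℚ) ≤ p`», modulo (γ) and five
print facts by name. Of the 18 rank-2 depth-table rows (Cremona `N ≤ 1000`, `p ∈ {5, 7}`), `p` splits in
`K` exactly at `664a1 (5, −39)`, `707a1 (5, −19)`, `916c1 (5, −111)`, `944e1 (5, −31)`. This file
instantiates the reading at the first three, discharging EVERY per-curve side condition in the kernel: two
independent points (`Rank2ObservatoryKernelCerts*.C<label>.two_le_rank`), non-CM and the `5`-adic tower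
onto (`C<label>.not_hasCM`, `hasSurjectiveModNGaloisRep_pow_5`, g9/g10), `5` good ordinary
(`goodOrdinary_5`), the Kodaira–Néron condition from the discriminant table
(`not_dvd_ordMinimalDiscriminant_of_intModel_table`), the Heegner hypothesis for `N_E` and the splitting
of `5` from Kronecker symbols (`satisfiesHeegnerHypothesis_iff_kronecker`). (`944e1` is omitted: its
additive prime `2` has `v₂(Δ) = 10`, outside the table lemma's format.) The inert rows are in
`KolyvaginDepthDoorDepthTableRowsExactReadingZhang{1,2}`.

RESULT, per row, for ANY imaginary quadratic `K` with the listed `d_K`: the depth table's bit «some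
Kolyvagin prime `ℓ` carries a datum with `c_1(ℓ) ≠ 0`» is EXACTLY «`rank E(ℚ) = 2` ∧ `Ш(E)[5] = 0` ∧
`#Sel_5(E^{(d_K)}) ≤ 5`» — modulo (γ) = Gross 1991 Prop. 3.7 (2) and the five print facts (Castella–Sano
Thm. 3, Zanarella 2.18, Howard–Zanarella, modularity, Mazur 1978 Cor. 4.1). No `hF`, no twist point, no
twist pinning, no `Ш`-hypothesis, no 2-descent. CONDITIONAL on those named facts; per curve; BSD is NOT
proved by any of this.

References: [GrossLMS1991] Prop. 3.7 (2); [CastellaSano2026] Thm. 3; [Zanarella2019] Prop. 2.18;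
[Howard2004] Lemma 1.6.4; [Mazur1978] Cor. 4.1; [JetchevLauterStein2009] §3.6 (arXiv:0707.0032);
[CremonaAlgorithms1997] Table 1; [Marcus1977] Ch. 3 Thm. 25.
-/

set_option linter.dupNamespace false

noncomputable section

open scoped Classical NumberField

namespace Summit.BirchSwinnertonDyer.BirchSwinnertonDyer.Theorems.KolyvaginDepthDoor

open Literature.NumberTheory.EllipticCurves Literature.NumberTheory.EllipticCurves.ModularForms
  WeierstrassCurve NumberField IsDedekindDomain
open Summit.BirchSwinnertonDyer.BirchSwinnertonDyer.Theorems
open Summit.BirchSwinnertonDyer.BirchSwinnertonDyer.Rank2Observatory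

/-- `5` splits in a quadratic field of discriminant `D` when `(D/5) = 1` (decomposition law, via
`satisfiesHeegnerHypothesis_iff_kronecker` at level `5`). [folklore] -/
private theorem satisfiesHeegnerHypothesis_five_of_jacobiSym (K : Type) [Field K] [NumberField K]
    (h2 : Module.finrank ℚ K = 2) {D : ℤ} (hD : NumberField.discr K = D) (hj : jacobiSym D 5 = 1) :
    SatisfiesHeegnerHypothesis 5 K := by
  rw [satisfiesHeegnerHypothesis_iff_kronecker 5 K h2, hD]
  intro q hq hq5
  have hq' : q = 5 := (Nat.prime_dvd_prime_iff_eq hq (by norm_num)).mp hq5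
  subst hq'
  exact ⟨fun h ↦ absurd h (by norm_num), fun _ ↦ hj⟩

/-! ## `664a1 = [0, 0, 0, -7, 10]` at `(p, d_K) = (5, -39)` (♠ (2)-residual curve: N = 2³·83; `Δ = -21248`; `5` split) -/

namespace C664a1

/-- **DEPTH-TABLE ROW `664a1`, `(p, d_K) = (5, −39)`, READ EXACTLY (two-sided; no `hF`, no twist
point, no twist pinning, no 2-descent).** For `E = 664a1` (two independent points by the kernel
certificate `KernelCerts001.C664a1.two_le_rank`) and ANY imaginary quadratic `K` with `d_K = −39`: «some frame, some
Kolyvagin prime `ℓ`, some datum of conductor `ℓ` with `c_1(ℓ) ≠ 0`» `↔` «`rank E(ℚ) = 2` ∧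
`Ш(E/ℚ)[5] = 0` ∧ `#Sel_5(E^{(−39)}/ℚ) ≤ 5`». Side conditions all kernel theorems (`5` good ordinary,
`ρ_{E,5^n}` onto, non-CM, Kodaira–Néron at `5` from `Δ = -21248`, Heegner for `N_E`, `5` split in `K`
as `(−39/5) = 1`). CONDITIONAL on (γ) and the five print facts; per curve; BSD is not proved by it.
[cite: GrossLMS1991, Prop. 3.7 (2)] [cite: CastellaSano2026, Thm. 3]
[cite: JetchevLauterStein2009, §3.6 (arXiv:0707.0032)] [cite: CremonaAlgorithms1997, Table 1 (664a1)] -/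
theorem exactRow_5_neg39
    (h372 : GrossLMS1991.prop37_2_frobeniusCongruence)
    (h3 : Literature.NumberTheory.EllipticCurves.CastellaSano2026_kolyvaginClass_selmerDivisibility_eq_padicValNat_tamagawaProduct)
    (hZ : Literature.NumberTheory.EllipticCurves.Zanarella2019_kolyvaginClass_one_ne_zero_of_not_selmerDivisible)
    (hHZ : Literature.NumberTheory.EllipticCurves.HowardZanarella_exists_minimal_kolyvaginClass_one_selmerCard_of_ne_zero)
    (hnf : exists_isNewformOf) (hMaz : mazur_not_dvd_maninConstant_of_odd)
    (K : Type) [Field K] [NumberField K] (hK : IsImaginaryQuadratic K)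
    (hD : NumberField.discr K = -39) :
    haveI := isElliptic_c664a1;
    haveI := isGloballyMinimal_c664a1;
    haveI : NeZero (((⟨0, 0, 0, -7, 10⟩ : WeierstrassCurve ℤ).map (Int.castRingHom ℚ)).conductorNorm ℤ) := neZero_conductorNorm_of_isElliptic _;
    haveI := Fact.mk (by norm_num : Nat.Prime 5);
    (∃ (Dt : ModularParametrizationData ((⟨0, 0, 0, -7, 10⟩ : WeierstrassCurve ℤ).map (Int.castRingHom ℚ)) (((⟨0, 0, 0, -7, 10⟩ : WeierstrassCurve ℤ).map (Int.castRingHom ℚ)).conductorNorm ℤ)) (β : ℤ)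
      (ι : K →+* ℂ) (ℓ : ℕ) (d : KolyvaginHeegnerData Dt β ι ℓ),
      ℓ.Prime ∧ Zhang2014.IsKolyvaginPrime (((⟨0, 0, 0, -7, 10⟩ : WeierstrassCurve ℤ).map (Int.castRingHom ℚ)).conductorNorm ℤ) ((⟨0, 0, 0, -7, 10⟩ : WeierstrassCurve ℤ).map (Int.castRingHom ℚ)) K 5 ℓ ∧
        d.kolyvaginClass (p := 5) (by norm_num) 1 ≠ 0) ↔
    (((⟨0, 0, 0, -7, 10⟩ : WeierstrassCurve ℤ).map (Int.castRingHom ℚ)).mordellWeilRank = 2 ∧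
      (((⟨0, 0, 0, -7, 10⟩ : WeierstrassCurve ℤ).map (Int.castRingHom ℚ)).sha ⊓ AddSubgroup.torsionBy ((⟨0, 0, 0, -7, 10⟩ : WeierstrassCurve ℤ).map (Int.castRingHom ℚ)).galH1 ((5 : ℕ) : ℤ) : AddSubgroup _) = ⊥ ∧
      Nat.card ((((⟨0, 0, 0, -7, 10⟩ : WeierstrassCurve ℤ).map (Int.castRingHom ℚ)).quadraticTwist (NumberField.discr K : ℚ)).selmerGroup (5 : ℕ)) ≤ 5) := by
  haveI := isElliptic_c664a1
  haveI := isGloballyMinimal_c664a1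
  haveI : NeZero (((⟨0, 0, 0, -7, 10⟩ : WeierstrassCurve ℤ).map (Int.castRingHom ℚ)).conductorNorm ℤ) := neZero_conductorNorm_of_isElliptic _
  haveI := Fact.mk (by norm_num : Nat.Prime 5)
  have hgo := goodOrdinary_5
  have hH := satisfiesHeegnerHypothesis_conductorNorm_of_intModel intModel K hK.1 hD heegner_neg39
  have hKN := not_dvd_ordMinimalDiscriminant_of_intModel_table intModel (p := 5) (Δ₀ := -21248)
    (by decide +kernel) (B := 11) (by decide +kernel) (by decide +kernel)
  have hodd : Odd (NumberField.discr K) := by rw [hD, Int.odd_iff]; norm_num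
  have hD3 : NumberField.discr K ≠ -3 := by rw [hD]; norm_num
  have hD4 : NumberField.discr K ≠ -4 := by rw [hD]; norm_num
  have hpD : ¬ (((5 : ℕ) : ℤ) ∣ NumberField.discr K) := by rw [hD]; norm_num
  have hspl : SatisfiesHeegnerHypothesis 5 K :=
    satisfiesHeegnerHypothesis_five_of_jacobiSym K hK.1 hD (by norm_num)
  exact kolyvaginClass_prime_ne_zero_iff_rankTwo_shaTrivial_twistSelmer_of_maninPrint h372 h3 hZ hHZ hnf
    hMaz _ not_hasCM KernelCerts001.C664a1.two_le_rank 5 (by norm_num) hgo.1 hgo.2 hasSurjectiveModNGaloisRep_pow_5 hKN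
    K hK hodd hD3 hD4 hpD hspl hH

end C664a1

/-! ## `707a1 = [0, 1, 1, -12, 12]` at `(p, d_K) = (5, -19)` (N = 7·101, W. Zhang's ♠ cell; `Δ = 4949`; `5` split) -/

namespace C707a1

/-- **DEPTH-TABLE ROW `707a1`, `(p, d_K) = (5, −19)`, READ EXACTLY (two-sided; no `hF`, no twist
point, no twist pinning, no 2-descent).** For `E = 707a1` (two independent points by the kernel
certificate `KernelCerts002.C707a1.two_le_rank`) and ANY imaginary quadratic `K` with `d_K = −19`: «some frame, some
Kolyvagin prime `ℓ`, some datum of conductor `ℓ` with `c_1(ℓ) ≠ 0`» `↔` «`rank E(ℚ) = 2` ∧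
`Ш(E/ℚ)[5] = 0` ∧ `#Sel_5(E^{(−19)}/ℚ) ≤ 5`». Side conditions all kernel theorems (`5` good ordinary,
`ρ_{E,5^n}` onto, non-CM, Kodaira–Néron at `5` from `Δ = 4949`, Heegner for `N_E`, `5` split in `K`
as `(−19/5) = 1`). CONDITIONAL on (γ) and the five print facts; per curve; BSD is not proved by it.
[cite: GrossLMS1991, Prop. 3.7 (2)] [cite: CastellaSano2026, Thm. 3]
[cite: JetchevLauterStein2009, §3.6 (arXiv:0707.0032)] [cite: CremonaAlgorithms1997, Table 1 (707a1)] -/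
theorem exactRow_5_neg19
    (h372 : GrossLMS1991.prop37_2_frobeniusCongruence)
    (h3 : Literature.NumberTheory.EllipticCurves.CastellaSano2026_kolyvaginClass_selmerDivisibility_eq_padicValNat_tamagawaProduct)
    (hZ : Literature.NumberTheory.EllipticCurves.Zanarella2019_kolyvaginClass_one_ne_zero_of_not_selmerDivisible)
    (hHZ : Literature.NumberTheory.EllipticCurves.HowardZanarella_exists_minimal_kolyvaginClass_one_selmerCard_of_ne_zero)
    (hnf : exists_isNewformOf) (hMaz : mazur_not_dvd_maninConstant_of_odd)
    (K : Type) [Field K] [NumberField K] (hK : IsImaginaryQuadratic K)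
    (hD : NumberField.discr K = -19) :
    haveI := isElliptic_c707a1;
    haveI := isGloballyMinimal_c707a1;
    haveI : NeZero (((⟨0, 1, 1, -12, 12⟩ : WeierstrassCurve ℤ).map (Int.castRingHom ℚ)).conductorNorm ℤ) := neZero_conductorNorm_of_isElliptic _;
    haveI := Fact.mk (by norm_num : Nat.Prime 5);
    (∃ (Dt : ModularParametrizationData ((⟨0, 1, 1, -12, 12⟩ : WeierstrassCurve ℤ).map (Int.castRingHom ℚ)) (((⟨0, 1, 1, -12, 12⟩ : WeierstrassCurve ℤ).map (Int.castRingHom ℚ)).conductorNorm ℤ)) (β : ℤ)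
      (ι : K →+* ℂ) (ℓ : ℕ) (d : KolyvaginHeegnerData Dt β ι ℓ),
      ℓ.Prime ∧ Zhang2014.IsKolyvaginPrime (((⟨0, 1, 1, -12, 12⟩ : WeierstrassCurve ℤ).map (Int.castRingHom ℚ)).conductorNorm ℤ) ((⟨0, 1, 1, -12, 12⟩ : WeierstrassCurve ℤ).map (Int.castRingHom ℚ)) K 5 ℓ ∧
        d.kolyvaginClass (p := 5) (by norm_num) 1 ≠ 0) ↔
    (((⟨0, 1, 1, -12, 12⟩ : WeierstrassCurve ℤ).map (Int.castRingHom ℚ)).mordellWeilRank = 2 ∧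
      (((⟨0, 1, 1, -12, 12⟩ : WeierstrassCurve ℤ).map (Int.castRingHom ℚ)).sha ⊓ AddSubgroup.torsionBy ((⟨0, 1, 1, -12, 12⟩ : WeierstrassCurve ℤ).map (Int.castRingHom ℚ)).galH1 ((5 : ℕ) : ℤ) : AddSubgroup _) = ⊥ ∧
      Nat.card ((((⟨0, 1, 1, -12, 12⟩ : WeierstrassCurve ℤ).map (Int.castRingHom ℚ)).quadraticTwist (NumberField.discr K : ℚ)).selmerGroup (5 : ℕ)) ≤ 5) := by
  haveI := isElliptic_c707a1
  haveI := isGloballyMinimal_c707a1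
  haveI : NeZero (((⟨0, 1, 1, -12, 12⟩ : WeierstrassCurve ℤ).map (Int.castRingHom ℚ)).conductorNorm ℤ) := neZero_conductorNorm_of_isElliptic _
  haveI := Fact.mk (by norm_num : Nat.Prime 5)
  have hgo := goodOrdinary_5
  have hH := satisfiesHeegnerHypothesis_conductorNorm_of_intModel intModel K hK.1 hD heegner_neg19
  have hKN := not_dvd_ordMinimalDiscriminant_of_intModel_table intModel (p := 5) (Δ₀ := 4949)
    (by decide +kernel) (B := 11) (by decide +kernel) (by decide +kernel)
  have hodd : Odd (NumberField.discr K) := by rw [hD, Int.odd_iff]; norm_num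
  have hD3 : NumberField.discr K ≠ -3 := by rw [hD]; norm_num
  have hD4 : NumberField.discr K ≠ -4 := by rw [hD]; norm_num
  have hpD : ¬ (((5 : ℕ) : ℤ) ∣ NumberField.discr K) := by rw [hD]; norm_num
  have hspl : SatisfiesHeegnerHypothesis 5 K :=
    satisfiesHeegnerHypothesis_five_of_jacobiSym K hK.1 hD (by norm_num)
  exact kolyvaginClass_prime_ne_zero_iff_rankTwo_shaTrivial_twistSelmer_of_maninPrint h372 h3 hZ hHZ hnf
    hMaz _ not_hasCM KernelCerts002.C707a1.two_le_rank 5 (by norm_num) hgo.1 hgo.2 hasSurjectiveModNGaloisRep_pow_5 hKN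
    K hK hodd hD3 hD4 hpD hspl hH

end C707a1

/-! ## `916c1 = [0, 0, 0, -4, 1]` at `(p, d_K) = (5, -111)` (♠ (2)-residual curve: N = 2²·229; `Δ = 3664`; `5` split) -/

namespace C916c1

/-- **DEPTH-TABLE ROW `916c1`, `(p, d_K) = (5, −111)`, READ EXACTLY (two-sided; no `hF`, no twist
point, no twist pinning, no 2-descent).** For `E = 916c1` (two independent points by the kernel
certificate `KernelCerts002.C916c1.two_le_rank`) and ANY imaginary quadratic `K` with `d_K = −111`: «some frame, some
Kolyvagin prime `ℓ`, some datum of conductor `ℓ` with `c_1(ℓ) ≠ 0`» `↔` «`rank E(ℚ) = 2` ∧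
`Ш(E/ℚ)[5] = 0` ∧ `#Sel_5(E^{(−111)}/ℚ) ≤ 5`». Side conditions all kernel theorems (`5` good ordinary,
`ρ_{E,5^n}` onto, non-CM, Kodaira–Néron at `5` from `Δ = 3664`, Heegner for `N_E`, `5` split in `K`
as `(−111/5) = 1`). CONDITIONAL on (γ) and the five print facts; per curve; BSD is not proved by it.
[cite: GrossLMS1991, Prop. 3.7 (2)] [cite: CastellaSano2026, Thm. 3]
[cite: JetchevLauterStein2009, §3.6 (arXiv:0707.0032)] [cite: CremonaAlgorithms1997, Table 1 (916c1)] -/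
theorem exactRow_5_neg111
    (h372 : GrossLMS1991.prop37_2_frobeniusCongruence)
    (h3 : Literature.NumberTheory.EllipticCurves.CastellaSano2026_kolyvaginClass_selmerDivisibility_eq_padicValNat_tamagawaProduct)
    (hZ : Literature.NumberTheory.EllipticCurves.Zanarella2019_kolyvaginClass_one_ne_zero_of_not_selmerDivisible)
    (hHZ : Literature.NumberTheory.EllipticCurves.HowardZanarella_exists_minimal_kolyvaginClass_one_selmerCard_of_ne_zero)
    (hnf : exists_isNewformOf) (hMaz : mazur_not_dvd_maninConstant_of_odd)
    (K : Type) [Field K] [NumberField K] (hK : IsImaginaryQuadratic K)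
    (hD : NumberField.discr K = -111) :
    haveI := isElliptic_c916c1;
    haveI := isGloballyMinimal_c916c1;
    haveI : NeZero (((⟨0, 0, 0, -4, 1⟩ : WeierstrassCurve ℤ).map (Int.castRingHom ℚ)).conductorNorm ℤ) := neZero_conductorNorm_of_isElliptic _;
    haveI := Fact.mk (by norm_num : Nat.Prime 5);
    (∃ (Dt : ModularParametrizationData ((⟨0, 0, 0, -4, 1⟩ : WeierstrassCurve ℤ).map (Int.castRingHom ℚ)) (((⟨0, 0, 0, -4, 1⟩ : WeierstrassCurve ℤ).map (Int.castRingHom ℚ)).conductorNorm ℤ)) (β : ℤ)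
      (ι : K →+* ℂ) (ℓ : ℕ) (d : KolyvaginHeegnerData Dt β ι ℓ),
      ℓ.Prime ∧ Zhang2014.IsKolyvaginPrime (((⟨0, 0, 0, -4, 1⟩ : WeierstrassCurve ℤ).map (Int.castRingHom ℚ)).conductorNorm ℤ) ((⟨0, 0, 0, -4, 1⟩ : WeierstrassCurve ℤ).map (Int.castRingHom ℚ)) K 5 ℓ ∧
        d.kolyvaginClass (p := 5) (by norm_num) 1 ≠ 0) ↔
    (((⟨0, 0, 0, -4, 1⟩ : WeierstrassCurve ℤ).map (Int.castRingHom ℚ)).mordellWeilRank = 2 ∧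
      (((⟨0, 0, 0, -4, 1⟩ : WeierstrassCurve ℤ).map (Int.castRingHom ℚ)).sha ⊓ AddSubgroup.torsionBy ((⟨0, 0, 0, -4, 1⟩ : WeierstrassCurve ℤ).map (Int.castRingHom ℚ)).galH1 ((5 : ℕ) : ℤ) : AddSubgroup _) = ⊥ ∧
      Nat.card ((((⟨0, 0, 0, -4, 1⟩ : WeierstrassCurve ℤ).map (Int.castRingHom ℚ)).quadraticTwist (NumberField.discr K : ℚ)).selmerGroup (5 : ℕ)) ≤ 5) := by
  haveI := isElliptic_c916c1
  haveI := isGloballyMinimal_c916c1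
  haveI : NeZero (((⟨0, 0, 0, -4, 1⟩ : WeierstrassCurve ℤ).map (Int.castRingHom ℚ)).conductorNorm ℤ) := neZero_conductorNorm_of_isElliptic _
  haveI := Fact.mk (by norm_num : Nat.Prime 5)
  have hgo := goodOrdinary_5
  have hH := satisfiesHeegnerHypothesis_conductorNorm_of_intModel intModel K hK.1 hD heegner_neg111
  have hKN := not_dvd_ordMinimalDiscriminant_of_intModel_table intModel (p := 5) (Δ₀ := 3664)
    (by decide +kernel) (B := 11) (by decide +kernel) (by decide +kernel)
  have hodd : Odd (NumberField.discr K) := by rw [hD, Int.odd_iff]; norm_num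
  have hD3 : NumberField.discr K ≠ -3 := by rw [hD]; norm_num
  have hD4 : NumberField.discr K ≠ -4 := by rw [hD]; norm_num
  have hpD : ¬ (((5 : ℕ) : ℤ) ∣ NumberField.discr K) := by rw [hD]; norm_num
  have hspl : SatisfiesHeegnerHypothesis 5 K :=
    satisfiesHeegnerHypothesis_five_of_jacobiSym K hK.1 hD (by norm_num)
  exact kolyvaginClass_prime_ne_zero_iff_rankTwo_shaTrivial_twistSelmer_of_maninPrint h372 h3 hZ hHZ hnf
    hMaz _ not_hasCM KernelCerts002.C916c1.two_le_rank 5 (by norm_num) hgo.1 hgo.2 hasSurjectiveModNGaloisRep_pow_5 hKN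
    K hK hodd hD3 hD4 hpD hspl hH

end C916c1

end Summit.BirchSwinnertonDyer.BirchSwinnertonDyer.Theorems.KolyvaginDepthDoor

end
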